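import Literature.IUT.HodgeTheaters.ThetaGeometryClaimsNonVacuityWitness
import Mathlib.GroupTheory.SpecificGroups.Cyclic
import HarnessLib

/-!
# The thirteen printed claims of [IUTchI] §1 pp. 37–38 HOLD at the claims model `pedClaimsOf`
# (`ArrowCoveringClaims`), and `ThetaGeometry ∧ pe.ArrowCoveringClaims` is JOINTLY inhabited — proof-only companion
# of the NV-L5 witness `ThetaGeometryClaimsNonVacuityWitness.lean` (abc-iut-L5-lead RULINGS #27 / #36 (1))

S. Mochizuki, *Inter-universal Teichmüller theory I*, RIMS manuscript (May 2020; = PRIMS **57** (2021)), §1 pp. 37–38,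
Def. 3.1 (b)(d)(f) pp. 61–63 ([IUTchI] §1 p.38) [claim: Mochizuki2012, status: disputed] (D-0012 claim key, series
status DISPUTED — theorems about a DEGENERATE π₁-side MODEL of two typed interfaces; nothing of the series is asserted
and no side is taken on [IUTchIII] Cor. 3.12).

Evaluation of abc-iut-L5-t1's construction (`modLKer`, `deltaEpsKer`, `jKer`, `piXarrow`, `galKer`, `piCarrow`) at the
model: `modLKer = deltaEpsKer = jKer = 1` (abelian finite factor; inertia of `ε⁰, 2ε` trivial; the commutators
`x c x⁻¹ c⁻¹` vanish), `Π_{X→} = G × 0`, `galKer = {1} × (ℤ/2 × 0 × 0)` (`l` odd), `Π_{C→} = G × (ℤ/2 × 0 × 0)`; then the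
thirteen clauses of `ArrowCoveringClaims` (`arrowCoveringClaims_pedClaimsOf`) and the JOINT witness
**`exists_thetaGeometry_arrowCoveringClaims`**.  Convention: subgroup EQUATIONS by `rw`, MEMBERSHIP by `.mp`/`.mpr` of
the `mem_*` lemmas (the ambient `(pedClaimsOf …).PiC` is only definitionally `G × Fin₃ l`).  Proof-only (0 defs).
-/

noncomputable section

namespace Literature.IUT.HodgeTheaters

namespace ThetaGeometryClaimsModel

open Literature.AnabelianGeometry.AbsoluteAnabelian Topology

universe u

/-! ## Arithmetic of the finite factor -/

section Fin

variable (l : ℕ)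

/-- `Nat.card (ℤ/n) = n` in multiplicative notation. [folklore] -/
private theorem card_mult_zmod' (n : ℕ) : Nat.card (Multiplicative (ZMod n)) = n := by
  rw [Nat.card_congr Multiplicative.toAdd, Nat.card_zmod]

/-- `l` prime to `6` is odd. [folklore] -/
private theorem odd_of_coprime_six (h6 : l.Coprime 6) : Odd l :=
  Nat.coprime_two_right.mp (h6.coprime_dvd_right (by norm_num))

/-- In `ℤ/2` (multiplicatively) an odd power is the identity map. [folklore] -/
private theorem pow_eq_self_of_coprime_six (h6 : l.Coprime 6) (s : Multiplicative (ZMod 2)) : s ^ l = s := by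
  obtain ⟨k, hk⟩ := odd_of_coprime_six l h6
  have hs : s ^ 2 = 1 := by
    have := pow_card_eq_one' (G := Multiplicative (ZMod 2)) (x := s)
    rwa [card_mult_zmod'] at this
  rw [hk, pow_succ, pow_mul, hs, one_pow, one_mul]

/-- `t ^ l = 1` in `ℤ/l` (multiplicatively). [folklore] -/
private theorem pow_l_eq_one_zmod [NeZero l] (t : Multiplicative (ZMod l)) : t ^ l = 1 := by
  have := pow_card_eq_one' (G := Multiplicative (ZMod l)) (x := t)
  rwa [card_mult_zmod'] at this

/-- `ℤ/2 × ℤ/l` is cyclic for `l` odd. [folklore] -/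
private theorem isCyclic_two_mul [NeZero l] (h6 : l.Coprime 6) :
    IsCyclic (Multiplicative (ZMod 2) × Multiplicative (ZMod l)) := by
  rw [Group.isCyclic_prod_iff]
  refine ⟨inferInstance, inferInstance, ?_⟩
  rw [card_mult_zmod', card_mult_zmod']
  exact Nat.coprime_two_left.mpr (odd_of_coprime_six l h6)

/-- `|0 × ℤ/l × 0| = l`. [folklore] -/
private theorem card_finXbar [NeZero l] : Nat.card (finXbar l) = l := by
  have h := Subgroup.card_mul_index (finXbar l)
  rw [finXbar_index, Nat.card_prod, Nat.card_prod, card_mult_zmod', card_mult_zmod'] at h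
  nlinarith [h, NeZero.pos l]

/-- `(0 × ℤ/l × 0) ∩ (ℤ/2 × 0 × 0) = 0` (used for the cartesian square). ([IUTchI] §1 p.37) [claim: Mochizuki2012, status: disputed] -/
theorem finXbar_inf_finGal : finXbar l ⊓ finGal l = ⊥ := by
  ext x
  simp only [Subgroup.mem_inf, mem_finXbar, mem_finGal, Subgroup.mem_bot, Prod.ext_iff, Prod.fst_one,
    Prod.snd_one]
  tauto

/-- `ℤ/2 × 0 × 0 ≤ ℤ/2 × ℤ/l × 0`. ([IUTchI] §1 p.37) [claim: Mochizuki2012, status: disputed] -/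
theorem finGal_le_finC : finGal l ≤ finC l := fun _ hx => mem_finC.mpr (mem_finGal.mp hx).2

/-- `[Fin₃ : ℤ/2 × 0 × 0] = l²`. ([IUTchI] §1 p.37) [claim: Mochizuki2012, status: disputed] -/
theorem finGal_index [NeZero l] : (finGal l).index = l * l := by
  simp only [finGal, Subgroup.index_prod, Subgroup.index_top, Subgroup.index_bot, card_mult_zmod', one_mul]

/-- `|Fin₃| = 2l²`. ([IUTchI] §1 p.37) [claim: Mochizuki2012, status: disputed] -/
theorem bot_fin_index [NeZero l] : (⊥ : Subgroup (Fin₃ l)).index = 2 * (l * l) := by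
  simp only [Subgroup.index_bot, Nat.card_prod, card_mult_zmod']

end Fin

/-! ## The construction of pp. 37–38 evaluated at the model -/

section Claims

variable (G : Type u) [Group G] [TopologicalSpace G] [IsTopologicalGroup G] [CompactSpace G]
  [TotallyDisconnectedSpace G] (l : ℕ) [NeZero l] (h5 : 5 ≤ l) (h6 : l.Coprime 6)

/-- `D_{ε′} = Π_X̲`. ([IUTchI] §1 p.37) [claim: Mochizuki2012, status: disputed] -/
theorem decomp_ε1 : (pedClaimsOf G l h5 h6).decomp (pedClaimsOf G l h5 h6).ε1 = lift G l (finXbar l) := by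
  show decompOf G l ⟨1⟩ = _; unfold decompOf; rw [if_pos (Or.inl rfl)]

/-- `D_{ε″} = Π_X̲`. ([IUTchI] §1 p.37) [claim: Mochizuki2012, status: disputed] -/
theorem decomp_ε2 : (pedClaimsOf G l h5 h6).decomp (pedClaimsOf G l h5 h6).ε2 = lift G l (finXbar l) := by
  show decompOf G l ⟨2⟩ = _; unfold decompOf; rw [if_pos (Or.inr rfl)]

/-- `D_{2ε} = G × 0`. ([IUTchI] §1 p.37) [claim: Mochizuki2012, status: disputed] -/
theorem decomp_twoε : (pedClaimsOf G l h5 h6).decomp (pedClaimsOf G l h5 h6).twoε = lift G l ⊥ :=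
  decompOf_of_ne G l (x := ⟨3⟩) (by decide) (by decide)

/-- `Δ_X̲ = {1} × (0 × ℤ/l × 0)`: membership. ([IUTchI] §1 p.37) [claim: Mochizuki2012, status: disputed] -/
theorem mem_deltaXbar {x : G × Fin₃ l} :
    x ∈ (pedClaimsOf G l h5 h6).DeltaXbar ↔ x.1 = 1 ∧ x.2.1 = 1 ∧ x.2.2.2 = 1 := by
  rw [PuncturedEllipticData.DeltaXbar, piXbar_eq]
  constructor
  · intro h
    exact ⟨(mem_deltaC G l h5 h6).mp h.2, mem_finXbar.mp (mem_lift.mp h.1)⟩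
  · rintro ⟨h1, h2⟩
    exact ⟨mem_lift.mpr (mem_finXbar.mpr h2), (mem_deltaC G l h5 h6).mpr h1⟩

/-- `Δ_C̲ = {1} × (ℤ/2 × ℤ/l × 0)`: membership. ([IUTchI] §1 p.37) [claim: Mochizuki2012, status: disputed] -/
theorem mem_deltaCbar {x : G × Fin₃ l} :
    x ∈ (pedClaimsOf G l h5 h6).DeltaCbar ↔ x.1 = 1 ∧ x.2.2.2 = 1 := by
  rw [PuncturedEllipticData.DeltaCbar]
  constructor
  · intro h
    exact ⟨(mem_deltaC G l h5 h6).mp h.2, mem_finC.mp (mem_lift.mp h.1)⟩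
  · rintro ⟨h1, h2⟩
    exact ⟨mem_lift.mpr (mem_finC.mpr h2), (mem_deltaC G l h5 h6).mpr h1⟩

/-! Convention: subgroup EQUATIONS are rewritten with `rw`; MEMBERSHIP facts are moved with `.mp`/`.mpr` of the
`mem_*` lemmas (the ambient type `(pedClaimsOf …).PiC` is only definitionally `G × Fin₃ l`). -/

/-- Elements of `Δ_X̲ = {1} × (0 × ℤ/l × 0)` have trivial `l`-th power. ([IUTchI] §1 p.37) [claim: Mochizuki2012, status: disputed] -/
theorem pow_l_eq_one_of_mem_deltaXbar {y : G × Fin₃ l} (hy : y ∈ (pedClaimsOf G l h5 h6).DeltaXbar) :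
    y ^ l = 1 := by
  obtain ⟨h1, h2, h3⟩ := (mem_deltaXbar G l h5 h6).mp hy
  refine Prod.ext ?_ (Prod.ext ?_ (Prod.ext ?_ ?_))
  · change y.1 ^ l = 1
    rw [h1, one_pow]
  · change y.2.1 ^ l = 1
    rw [h2, one_pow]
  · change y.2.2.1 ^ l = 1
    exact pow_l_eq_one_zmod l _
  · change y.2.2.2 ^ l = 1
    rw [h3, one_pow]

/-- In a `T₁` topological group the trivial subgroup is topologically closed. [folklore] -/
private theorem topologicalClosure_bot {Ω : Type*} [Group Ω] [TopologicalSpace Ω] [IsTopologicalGroup Ω]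
    [T1Space Ω] : (⊥ : Subgroup Ω).topologicalClosure = ⊥ :=
  le_antisymm (Subgroup.topologicalClosure_minimal _ le_rfl
    (by rw [Subgroup.coe_bot]; exact isClosed_singleton)) bot_le

/-- `Ker(Δ_X̲ ↠ Δ_X̲^{ab} ⊗ ℤ/l) = 1` in the model (`Δ_X̲ ≅ ℤ/l`). ([IUTchI] §1 p.37) [claim: Mochizuki2012, status: disputed] -/
theorem modLKer_eq_bot : (pedClaimsOf G l h5 h6).modLKer = ⊥ := by
  rw [PuncturedEllipticData.modLKer]
  have hcomm : ⁅(pedClaimsOf G l h5 h6).DeltaXbar, (pedClaimsOf G l h5 h6).DeltaXbar⁆ = ⊥ := by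
    rw [Subgroup.commutator_eq_bot_iff_le_centralizer]
    intro x hx
    rw [Subgroup.mem_centralizer_iff]
    intro y hy
    have hx1 := ((mem_deltaXbar G l h5 h6).mp hx).1
    have hy1 := ((mem_deltaXbar G l h5 h6).mp hy).1
    change y * x = x * y
    refine Prod.ext ?_ ?_
    · change y.1 * x.1 = x.1 * y.1
      rw [hx1, hy1]
    · change y.2 * x.2 = x.2 * y.2
      exact mul_comm _ _
  have hpow : Subgroup.closure ((fun y => y ^ (pedClaimsOf G l h5 h6).l) ''
      ((pedClaimsOf G l h5 h6).DeltaXbar : Set (pedClaimsOf G l h5 h6).PiC)) = ⊥ := by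
    rw [Subgroup.closure_eq_bot_iff]
    rintro _ ⟨y, hy, rfl⟩
    exact pow_l_eq_one_of_mem_deltaXbar G l h5 h6 hy
  rw [hcomm, hpow, bot_sup_eq]
  exact topologicalClosure_bot

/-- The inertia groups of the cusps `≠ ε′, ε″` are trivial. ([IUTchI] §1 p.37) [claim: Mochizuki2012, status: disputed] -/
theorem inertia_eq_bot_of_ne {x : ULift.{u} (Fin 4)} (h1 : x ≠ ⟨1⟩) (h2 : x ≠ ⟨2⟩) :
    (pedClaimsOf G l h5 h6).inertia x = ⊥ := by
  rw [PuncturedEllipticData.inertia, eq_bot_iff]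
  intro y hy
  have hd : y ∈ decompOf G l x := hy.1
  rw [decompOf_of_ne G l h1 h2] at hd
  have hd' : y.2 = 1 := mem_lift.mp hd
  have hg : y.1 = 1 := (mem_deltaC G l h5 h6).mp hy.2
  exact (Subgroup.mem_bot).mpr (Prod.ext hg hd')

/-- `Ker(Δ_X̲ ↠ Δ_ε) = 1` in the model. ([IUTchI] §1 p.37) [claim: Mochizuki2012, status: disputed] -/
theorem deltaEpsKer_eq_bot : (pedClaimsOf G l h5 h6).deltaEpsKer = ⊥ := by
  rw [PuncturedEllipticData.deltaEpsKer, modLKer_eq_bot, bot_sup_eq, iSup_eq_bot]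
  rintro ⟨x, -, hx1, hx2⟩
  exact inertia_eq_bot_of_ne G l h5 h6 hx1 hx2

/-- **`jKer = 1`** in the model (every commutator `x c x⁻¹ c⁻¹` vanishes). ([IUTchI] §1 p.38) [claim: Mochizuki2012, status: disputed] -/
theorem jKer_eq_bot : (pedClaimsOf G l h5 h6).jKer = ⊥ := by
  rw [PuncturedEllipticData.jKer, deltaEpsKer_eq_bot, bot_sup_eq, Subgroup.closure_eq_bot_iff]
  rintro z ⟨x, -, c, hc, -, rfl⟩
  exact comm_eq_one_of_fst_eq_one G l x c ((mem_deltaCbar G l h5 h6).mp hc).1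

/-- **`Π_{X→} = G × 0`** in the model. ([IUTchI] §1 p.38) [claim: Mochizuki2012, status: disputed] -/
theorem piXarrow_eq : (pedClaimsOf G l h5 h6).piXarrow = lift G l ⊥ := by
  rw [PuncturedEllipticData.piXarrow, jKer_eq_bot, sup_bot_eq, decomp_twoε]

/-- The `l`-th powers of `Δ_C̲` generate exactly `{1} × (ℤ/2 × 0 × 0)`, i.e. `galKer = {1} × (ℤ/2 × 0 × 0)`.
([IUTchI] §1 p.38) [claim: Mochizuki2012, status: disputed] -/
theorem mem_galKer {z : G × Fin₃ l} :
    z ∈ (pedClaimsOf G l h5 h6).galKer ↔ z.1 = 1 ∧ z.2.2.1 = 1 ∧ z.2.2.2 = 1 := by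
  rw [PuncturedEllipticData.galKer, jKer_eq_bot, bot_sup_eq]
  constructor
  · intro hz
    refine Subgroup.closure_induction (p := fun w _ => w.1 = 1 ∧ w.2.2.1 = 1 ∧ w.2.2.2 = 1) ?_ ?_ ?_ ?_ hz
    · rintro _ ⟨y, hy, rfl⟩
      obtain ⟨hy1, hy3⟩ := (mem_deltaCbar G l h5 h6).mp hy
      refine ⟨?_, ?_, ?_⟩
      · change y.1 ^ l = 1
        rw [hy1, one_pow]
      · change y.2.2.1 ^ l = 1
        exact pow_l_eq_one_zmod l _
      · change y.2.2.2 ^ l = 1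
        rw [hy3, one_pow]
    · exact ⟨rfl, rfl, rfl⟩
    · rintro a b _ _ ⟨ha1, ha2, ha3⟩ ⟨hb1, hb2, hb3⟩
      refine ⟨?_, ?_, ?_⟩
      · change a.1 * b.1 = 1
        rw [ha1, hb1, one_mul]
      · change a.2.2.1 * b.2.2.1 = 1
        rw [ha2, hb2, one_mul]
      · change a.2.2.2 * b.2.2.2 = 1
        rw [ha3, hb3, one_mul]
    · rintro a _ ⟨ha1, ha2, ha3⟩
      refine ⟨?_, ?_, ?_⟩
      · change (a.1)⁻¹ = 1
        rw [ha1, inv_one]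
      · change (a.2.2.1)⁻¹ = 1
        rw [ha2, inv_one]
      · change (a.2.2.2)⁻¹ = 1
        rw [ha3, inv_one]
  · rintro ⟨hz1, hz2, hz3⟩
    have hzC : z ∈ (pedClaimsOf G l h5 h6).DeltaCbar := (mem_deltaCbar G l h5 h6).mpr ⟨hz1, hz3⟩
    have hzl : z ^ (pedClaimsOf G l h5 h6).l = z := by
      refine Prod.ext ?_ (Prod.ext ?_ (Prod.ext ?_ ?_))
      · change z.1 ^ l = z.1
        rw [hz1, one_pow]
      · change z.2.1 ^ l = z.2.1
        exact pow_eq_self_of_coprime_six l h6 _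
      · change z.2.2.1 ^ l = z.2.2.1
        rw [hz2, one_pow]
      · change z.2.2.2 ^ l = z.2.2.2
        rw [hz3, one_pow]
    exact Subgroup.subset_closure ⟨z, hzC, hzl⟩

/-- **`Π_{C→} = G × (ℤ/2 × 0 × 0)`** in the model. ([IUTchI] §1 p.38) [claim: Mochizuki2012, status: disputed] -/
theorem piCarrow_eq : (pedClaimsOf G l h5 h6).piCarrow = lift G l (finGal l) := by
  rw [PuncturedEllipticData.piCarrow, decomp_twoε]
  refine le_antisymm (sup_le (lift_mono G l bot_le) ?_) ?_
  · intro z hz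
    obtain ⟨-, hz2, hz3⟩ := (mem_galKer G l h5 h6).mp hz
    exact mem_lift.mpr (mem_finGal.mpr ⟨hz2, hz3⟩)
  · intro z hz
    obtain ⟨hz2, hz3⟩ := mem_finGal.mp (mem_lift.mp hz)
    have h1 : ((z.1, 1) : G × Fin₃ l) ∈ lift G l ⊥ := mem_lift.mpr (Subgroup.one_mem _)
    have h2 : ((1, z.2) : G × Fin₃ l) ∈ (pedClaimsOf G l h5 h6).galKer :=
      (mem_galKer G l h5 h6).mpr ⟨rfl, hz2, hz3⟩
    have h12 := Subgroup.mul_mem_sup h1 h2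
    rwa [Prod.fst_mul_snd] at h12

/-- **All thirteen printed claims of [IUTchI] pp. 37–38 hold for the model datum** (`ArrowCoveringClaims`):
indices `[Δ_X̲ : jKer] = l`, `[Π_C̲ : Π_{X→}] = 2l`, `[Π_C̲ : Π_{C→}] = l`, `I_{ε′} · jKer = I_{ε″} · jKer = Δ_X̲`,
`Π_{X→} ∩ Δ_C = jKer`, `Π_{X→} ↠ G`, the cartesian square `Π_{X→} = Π_X̲ ∩ Π_{C→}`, normality, and the cyclic
quotients `ℤ/2 × ℤ/l ≅ ℤ/2l`, `ℤ/l`.  DEGENERATE π₁-side model — a joint-consistency witness, not a curve.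
([IUTchI] §1 p.38) [claim: Mochizuki2012, status: disputed] -/
theorem arrowCoveringClaims_pedClaimsOf : (pedClaimsOf G l h5 h6).ArrowCoveringClaims where
  jKer_normal := by rw [jKer_eq_bot, Subgroup.bot_subgroupOf]; infer_instance
  jKer_relindex := by
    have e : (pedClaimsOf G l h5 h6).DeltaXbar ≃ finXbar l :=
      { toFun := fun y => ⟨y.1.2, mem_finXbar.mpr ((mem_deltaXbar G l h5 h6).mp y.2).2⟩
        invFun := fun d => ⟨((1 : G), d.1), (mem_deltaXbar G l h5 h6).mpr ⟨rfl, mem_finXbar.mp d.2⟩⟩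
        left_inv := fun y => Subtype.ext (Prod.ext ((mem_deltaXbar G l h5 h6).mp y.2).1.symm rfl)
        right_inv := fun _ => rfl }
    rw [jKer_eq_bot, Subgroup.relIndex_bot_left, Nat.card_congr e, card_finXbar, pedClaimsOf_l]
  inertia_ε1_sup := by
    rw [jKer_eq_bot, sup_bot_eq, PuncturedEllipticData.inertia, PuncturedEllipticData.DeltaXbar, piXbar_eq,
      decomp_ε1]
  inertia_ε2_sup := by
    rw [jKer_eq_bot, sup_bot_eq, PuncturedEllipticData.inertia, PuncturedEllipticData.DeltaXbar, piXbar_eq,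
      decomp_ε2]
  piXarrow_inf_delta := by
    rw [piXarrow_eq, jKer_eq_bot, eq_bot_iff]
    intro y hy
    exact (Subgroup.mem_bot).mpr (Prod.ext ((mem_deltaC G l h5 h6).mp hy.2) (mem_lift.mp hy.1))
  aug_piXarrow := by
    rw [piXarrow_eq]
    exact fst_lift_surjective G l ⊥
  cartesian := by
    rw [piXarrow_eq, piXbar_eq, piCarrow_eq]
    show lift G l ⊥ = lift G l (finXbar l) ⊓ lift G l (finGal l)
    rw [lift_inf, finXbar_inf_finGal]
  piXarrow_normal := by
    rw [piXarrow_eq]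
    exact (lift_normal G l ⊥).subgroupOf _
  piCarrow_normal := by
    rw [piCarrow_eq]
    exact (lift_normal G l (finGal l)).subgroupOf _
  piXarrow_relindex := by
    rw [piXarrow_eq, pedClaimsOf_l]
    have h := lift_relIndex G l (D := ⊥) (D' := finC l) bot_le
    rw [finC_index, bot_fin_index] at h
    show (lift G l ⊥).relIndex (lift G l (finC l)) = 2 * l
    have hl : 0 < l := NeZero.pos l
    nlinarith [h, hl]
  piCarrow_relindex := by
    rw [piCarrow_eq, pedClaimsOf_l]
    have h := lift_relIndex G l (finGal_le_finC (l := l))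
    rw [finC_index, finGal_index] at h
    show (lift G l (finGal l)).relIndex (lift G l (finC l)) = l
    have hl : 0 < l := NeZero.pos l
    nlinarith [h, hl]
  galX_cyclic := by
    intro hN
    haveI := isCyclic_two_mul l h6
    let ψ : Multiplicative (ZMod 2) × Multiplicative (ZMod l) →* (pedClaimsOf G l h5 h6).PiCbar :=
      { toFun := fun x => ⟨((1 : G), (x.1, (x.2, 1))), mem_lift.mpr (mem_finC.mpr rfl)⟩
        map_one' := rfl
        map_mul' := fun _ _ =>
          Subtype.ext (Prod.ext (one_mul 1).symm (Prod.ext rfl (Prod.ext rfl (one_mul 1).symm))) }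
    have hψ : ∀ x, (ψ x).val = ((1 : G), (x.1, (x.2, 1))) := fun _ => rfl
    refine isCyclic_of_surjective ((QuotientGroup.mk' _).comp ψ) ?_
    intro q
    obtain ⟨⟨x, hx⟩, rfl⟩ := QuotientGroup.mk_surjective q
    have hx' : x.2.2.2 = 1 := mem_finC.mp (mem_lift.mp hx)
    refine ⟨(x.2.1, x.2.2.1), ?_⟩
    rw [MonoidHom.comp_apply, QuotientGroup.mk'_apply, QuotientGroup.eq, Subgroup.mem_subgroupOf, piXarrow_eq]
    refine mem_lift.mpr ((Subgroup.mem_bot).mpr ?_)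
    rw [Subgroup.coe_mul, Subgroup.coe_inv, hψ]
    refine Prod.ext ?_ (Prod.ext ?_ ?_)
    · show (x.2.1)⁻¹ * x.2.1 = 1
      exact inv_mul_cancel _
    · show (x.2.2.1)⁻¹ * x.2.2.1 = 1
      exact inv_mul_cancel _
    · show (1 : Multiplicative (ZMod l))⁻¹ * x.2.2.2 = 1
      rw [inv_one, one_mul, hx']
  galC_cyclic := by
    intro hN
    let ψ : Multiplicative (ZMod 2) × Multiplicative (ZMod l) →* (pedClaimsOf G l h5 h6).PiCbar :=
      { toFun := fun x => ⟨((1 : G), (x.1, (x.2, 1))), mem_lift.mpr (mem_finC.mpr rfl)⟩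
        map_one' := rfl
        map_mul' := fun _ _ =>
          Subtype.ext (Prod.ext (one_mul 1).symm (Prod.ext rfl (Prod.ext rfl (one_mul 1).symm))) }
    have hψ : ∀ x, (ψ x).val = ((1 : G), (x.1, (x.2, 1))) := fun _ => rfl
    refine isCyclic_of_surjective ((QuotientGroup.mk' _).comp (ψ.comp (MonoidHom.inr _ _))) ?_
    intro q
    obtain ⟨⟨x, hx⟩, rfl⟩ := QuotientGroup.mk_surjective q
    have hx' : x.2.2.2 = 1 := mem_finC.mp (mem_lift.mp hx)
    refine ⟨x.2.2.1, ?_⟩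
    rw [MonoidHom.comp_apply, MonoidHom.comp_apply, QuotientGroup.mk'_apply, QuotientGroup.eq,
      Subgroup.mem_subgroupOf, piCarrow_eq]
    refine mem_lift.mpr (mem_finGal.mpr ⟨?_, ?_⟩)
    · rw [Subgroup.coe_mul, Subgroup.coe_inv, hψ]
      show (x.2.2.1)⁻¹ * x.2.2.1 = 1
      exact inv_mul_cancel _
    · rw [Subgroup.coe_mul, Subgroup.coe_inv, hψ]
      show (1 : Multiplicative (ZMod l))⁻¹ * x.2.2.2 = 1
      rw [inv_one, one_mul, hx']

end Claims

/-! ## The joint witness: `ThetaGeometry` inhabitants whose `pe` satisfies the printed §1 claims -/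

section Theta

variable {GF : Type u} [Group GF] [TopologicalSpace GF] [IsTopologicalGroup GF] [CompactSpace GF]
  [TotallyDisconnectedSpace GF] (GK : Subgroup GF) (l : ℕ) [NeZero l]

/-- **NV-L5 «ThetaGeometry.pe.ArrowCoveringClaims (JOINT)»: for every compact totally disconnected `G_F`, closed
`G_K ⊆ G_F` and `l ≥ 5` prime to `6` there is a `ThetaGeometry G_F G_K l` whose §1 datum satisfies all printed claims of
[IUTchI] pp. 37–38** (witness `geometryClaimsOf`; DEGENERATE π₁-side model — consistency of the typed interfaces,
not evidence about the curves). ([IUTchI] §1 p.38) [claim: Mochizuki2012, status: disputed] -/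
theorem exists_thetaGeometry_arrowCoveringClaims (hGK : IsClosed (GK : Set GF)) (h5 : 5 ≤ l) (h6 : l.Coprime 6) :
    ∃ T : ThetaGeometry GF GK l, T.pe.ArrowCoveringClaims := by
  haveI : CompactSpace GK := isCompact_iff_compactSpace.mp hGK.isCompact
  exact ⟨geometryClaimsOf GK l hGK h5 h6, arrowCoveringClaims_pedClaimsOf GK l h5 h6⟩

/-- The `pe` of `geometryClaimsOf` satisfies the claims (named form). ([IUTchI] §1 p.38) [claim: Mochizuki2012, status: disputed] -/
theorem arrowCoveringClaims_geometryClaimsOf (hGK : IsClosed (GK : Set GF)) (h5 : 5 ≤ l) (h6 : l.Coprime 6) :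
    (geometryClaimsOf GK l hGK h5 h6).pe.ArrowCoveringClaims := by
  haveI : CompactSpace GK := isCompact_iff_compactSpace.mp hGK.isCompact
  exact arrowCoveringClaims_pedClaimsOf GK l h5 h6

end Theta

end ThetaGeometryClaimsModel

end Literature.IUT.HodgeTheaters

end
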